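import Summits.ValiantsHypothesis.ValiantsHypothesis.Theorems.KPlusLogSqLawTropicalBEpochLaw

/-!
# Route «KPlusLogSqLaw», crux `TropicalB` (stmt-ValiantsHypothesis-19771) — THE LEX GAP LAW: super-increasing exponents with additive slack `g`
# and valuations `|v| ≤ R` give `n + 1 ≤ 2·⌊2mR/g⌋ + 3` — the scale-invariant form of the valuation-spread law in the lex sector

HONEST FRAMING.  Sequel of `…TropicalBEpochLaw` / `…TropicalBInertClasses` (this seat; `--supports … --as helper`) toward the registered stubs of
`Cruxes/TropicalB/Lines/birth.lean` (crux `Summit.ValiantsHypothesis.ValiantsHypothesis.Theses.KPlusLogSqLaw.TropicalB`, item stmt-ValiantsHypothesis-19771,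
route KPlusLogSqLaw, DRAFT; cell `pub-symmetroid`, seat val-sym-trop-p1 g12, 2026-08-27).  A SECTOR law (pure lexicographic exponents, bounded valuations);
it is R-dependent, hence invisible to `TropicalB` itself (`…TropicalBRationalSlopes`: scaling `v` is free there) — calibration for the construction side,
nothing on `TropicalB` in its window, `WeakLifting`, the doors, `MatrixDescartes` (stmt-ValiantsHypothesis-18050) or VP ≠ VNP.

THE LAW.  Exponents SUPER-INCREASING WITH SLACK `g ≥ 1`: `d l' < d l → m·d l' + g ≤ d l`, and `g ≤ d l` for every positive value (so the least
positive value is `≥ g`); valuations `|v| ≤ R`.  Put `θ⋆ = ⌊2mR/g⌋ + 1`.  At an integer slope `θ` with `|θ| ≥ θ⋆` EVERY positive value `D` is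
frozen — `|θ|·(D − m·D') ≥ |θ|·g > 2mR` for all smaller values `D'` (`slope_gap_theta`, `weight_gap_theta`) — so any two optima at slopes `≥ θ⋆`
(resp. `≤ −θ⋆`) have the same count of every positive value (`countVal_eq_far`), hence the same slope: the chain has at most ONE term beyond `θ⋆` on
each side, and trivially at most `θ⋆ − 1` terms at the integer slopes `1, …, θ⋆ − 1`:
* `LexGap.card_far_le_one`, `LexGap.card_near_le` — the two counts per sign;
* `LexGap.chain_le` — **`n + 1 ≤ 2·(⌊2mR/g⌋ + 1) + 1`** for every chain of unique optima at strictly increasing integer slopes with distinct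
  consecutive terms.
READING (located).  The tree's valuation-spread law (`NewtonPolygon.chain_le_valSpread`: `n ≤ 2m(V₁ − V₀) + 1 ≤ 4mR + 1`) is not invariant under
the symmetry `(d, v) ↦ (λd, λv)` of dominance; in the lex sector the invariant quantity is `R/g`, and the law reads «valuations must exceed
`n·g/(4m)`»: the additive slack above `m·(previous value)` is paid for linearly in valuation size (SHIFT-THREE: `g = 1`).  The `K`-free epoch law
(`Epoch.chain_le_sharp`, `2m + 5`) is the far end `g > 4mR` (then `θ⋆ = 1`; its sharper count uses that the value `0` carries no slope).
[folklore: exchange bookkeeping at integer slopes; this file]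
-/

set_option linter.dupNamespace false
set_option autoImplicit false

namespace Summit.ValiantsHypothesis.ValiantsHypothesis.Theorems.KPlusLogSqLaw

namespace LexGap

open Summit.ValiantsHypothesis.ValiantsHypothesis.Theorems.MatrixDescartes.Negative
open Summit.ValiantsHypothesis.ValiantsHypothesis.Theorems.LacunarySymmetroidMatrixDescartes.TropicalCensus
open Finset
open scoped BigOperators

variable {m K : ℕ}

/-! ## 1. The freezing exchange at a large slope -/

/-- **Slope gap at slope size `t`.**  Class maps `x, y` with equally many columns of every value `> D`, `#{d = D}` larger for `y`; `2mR < t·D` and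
every column of `x` of value `D' < D` has `t·m·D' + 2mR < t·D`.  Then `t·Σᵢ d (x i) + 2mR < t·Σᵢ d (y i)`. [this file] -/
theorem slope_gap_theta (d : Fin K → ℕ) (R t : ℕ) (x y : Fin m → Fin K) (D : ℕ) (hD : 2 * m * R < t * D)
    (hbelow : ∀ i, d (x i) < D → t * (m * d (x i)) + 2 * m * R < t * D)
    (habove : ∀ D' : ℕ, D < D' → (univ.filter fun i => d (x i) = D').card = (univ.filter fun i => d (y i) = D').card)
    (hcnt : (univ.filter fun i => d (x i) = D).card < (univ.filter fun i => d (y i) = D).card) :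
    t * ∑ i, d (x i) + 2 * m * R < t * ∑ i, d (y i) := by
  obtain ⟨i₀, _⟩ : ∃ i, d (y i) = D := by
    have hpos : 0 < (univ.filter fun i => d (y i) = D).card := by omega
    obtain ⟨i, hi⟩ := card_pos.mp hpos
    exact ⟨i, (mem_filter.mp hi).2⟩
  have hm : 0 < m := Fin.pos i₀
  set B := univ.filter (fun i => d (x i) < D) with hB
  have hBle : B.card ≤ m := (card_le_univ _).trans (by rw [Fintype.card_fin])
  -- `m·t·below + #B·(2mR+1) ≤ #B·t·D ≤ m·t·D`
  have hsum : m * (t * ∑ i ∈ B, d (x i)) + B.card * (2 * m * R + 1) ≤ B.card * (t * D) := by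
    rw [mul_sum, mul_sum, card_eq_sum_ones, sum_mul, sum_mul, ← sum_add_distrib]
    refine sum_le_sum fun i hi => ?_
    have := hbelow i (mem_filter.mp hi).2
    simp only [one_mul]
    nlinarith
  have hbelow' : t * ∑ i ∈ B, d (x i) + 2 * m * R + 1 ≤ t * D := by
    rcases Nat.eq_zero_or_pos B.card with h0 | hBpos
    · have : ∑ i ∈ B, d (x i) = 0 := by rw [card_eq_zero.mp h0, sum_empty]
      rw [this, mul_zero, zero_add]; omega
    · have h1 : m * (t * ∑ i ∈ B, d (x i)) + m * (2 * m * R + 1) ≤ m * (t * D) := by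
        have h2 : B.card * (t * D) ≤ m * (t * D) := Nat.mul_le_mul_right _ hBle
        nlinarith
      have h4 : m * (t * ∑ i ∈ B, d (x i) + 2 * m * R + 1) ≤ m * (t * D) := by
        rw [mul_add, mul_add] at *; omega
      exact Nat.le_of_mul_le_mul_left h4 hm
  have hx := sum_d_split3 d x D
  have hy := sum_d_split3 d y D
  rw [sum_above_eq_of_countVal d x y D habove] at hx
  have hDc : t * (D * (univ.filter fun i => d (x i) = D).card) + t * D ≤ t * (D * (univ.filter fun i => d (y i) = D).card) := by
    rw [← mul_add, ← Nat.mul_succ]; exact Nat.mul_le_mul_left t (Nat.mul_le_mul_left D hcnt)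
  have : ∑ i ∈ univ.filter (fun i => d (x i) < D), d (x i) = ∑ i ∈ B, d (x i) := rfl
  rw [hx, hy]
  rw [this]
  have hz : 0 ≤ t * ∑ i ∈ univ.filter (fun i => d (y i) < D), d (y i) := Nat.zero_le _
  nlinarith [hbelow', hDc, hz]

/-- **Weight gap at a slope with `|θ| = t`.**  Under the hypotheses of `slope_gap_theta` with `t = |θ|` and `|v| ≤ R`: `y` beats `x` if `θ > 0`, loses
if `θ < 0`. [this file] -/
theorem weight_gap_theta (d : Fin K → ℕ) (v : Fin m → Fin m → Fin K → ℤ) (R : ℕ) (hv : ∀ i j l, (v i j l).natAbs ≤ R)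
    {θ : ℤ} (x y : Equiv.Perm (Fin m) × (Fin m → Fin K)) (D : ℕ) (hD : 2 * m * R < θ.natAbs * D)
    (hbelow : ∀ i, d (x.2 i) < D → θ.natAbs * (m * d (x.2 i)) + 2 * m * R < θ.natAbs * D)
    (habove : ∀ D' : ℕ, D < D' → (univ.filter fun i => d (x.2 i) = D').card = (univ.filter fun i => d (y.2 i) = D').card)
    (hcnt : (univ.filter fun i => d (x.2 i) = D).card < (univ.filter fun i => d (y.2 i) = D).card) :
    (0 < θ → tropWeight d v θ x < tropWeight d v θ y) ∧ (θ < 0 → tropWeight d v θ y < tropWeight d v θ x) := by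
  have hgap := slope_gap_theta d R θ.natAbs x.2 y.2 D hD hbelow habove hcnt
  have hVx := (abs_le.mp (Epoch.abs_sum_v_le v R hv x))
  have hVy := (abs_le.mp (Epoch.abs_sum_v_le v R hv y))
  have hgapZ : (θ.natAbs : ℤ) * (∑ i, (d (x.2 i) : ℤ)) + 2 * (m : ℤ) * R < (θ.natAbs : ℤ) * ∑ i, (d (y.2 i) : ℤ) := by
    exact_mod_cast hgap
  unfold tropWeight
  constructor
  · intro hθ
    rw [Int.natAbs_of_nonneg hθ.le] at hgapZ
    linarith
  · intro hθ
    rw [Int.ofNat_natAbs_of_nonpos hθ.le] at hgapZ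
    linarith

/-! ## 2. Beyond `θ⋆` every positive value is frozen -/

/-- **Agreement beyond the threshold.**  Super-increasing exponents with slack `g` (`d l' < d l → m·d l' + g ≤ d l`; `g ≤` every positive value),
`|v| ≤ R`; two unique optima `p` (at `θa`) and `q` (at `θb`) with `θa, θb` of one sign and `2mR < |θa|·g`, `2mR < |θb|·g`.  Then `p` and `q` have
equally many columns of every positive value. [this file] -/
theorem countVal_eq_far (d : Fin K → ℕ) (v ε : Fin m → Fin m → Fin K → ℤ) (R g : ℕ) (hv : ∀ i j l, (v i j l).natAbs ≤ R)
    (hgap : ∀ l l' : Fin K, d l' < d l → m * d l' + g ≤ d l) (hg0 : ∀ l : Fin K, 0 < d l → g ≤ d l)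
    {θa θb : ℤ} (hsign : (0 < θa ∧ 0 < θb) ∨ (θa < 0 ∧ θb < 0))
    (hfa : 2 * m * R < θa.natAbs * g) (hfb : 2 * m * R < θb.natAbs * g)
    {p q : Equiv.Perm (Fin m) × (Fin m → Fin K)} (ha : IsDominant d v ε θa p) (hb : IsDominant d v ε θb q) :
    ∀ D : ℕ, 0 < D → (univ.filter fun i => d (p.2 i) = D).card = (univ.filter fun i => d (q.2 i) = D).card := by
  -- the frozen criterion of `weight_gap_theta` holds for every positive VALUE `d l` at both slopes
  have crit : ∀ (t : ℕ), 2 * m * R < t * g → ∀ l : Fin K, 0 < d l →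
      2 * m * R < t * d l ∧ ∀ (x : Fin m → Fin K) (i : Fin m), d (x i) < d l → t * (m * d (x i)) + 2 * m * R < t * d l := by
    intro t ht l hl
    refine ⟨ht.trans_le (Nat.mul_le_mul_left t (hg0 l hl)), fun x i hi => ?_⟩
    have h1 := hgap l (x i) hi
    calc t * (m * d (x i)) + 2 * m * R < t * (m * d (x i)) + t * g := by omega
      _ = t * (m * d (x i) + g) := by ring
      _ ≤ t * d l := Nat.mul_le_mul_left t h1
  by_contra hcon
  push Not at hcon
  obtain ⟨D', hD'0, hD'ne⟩ := hcon
  set T : Finset (Fin K) := univ.filter fun l =>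
    0 < d l ∧ (univ.filter fun i => d (p.2 i) = d l).card ≠ (univ.filter fun i => d (q.2 i) = d l).card with hT
  have hTne : T.Nonempty := by
    obtain ⟨l, hl⟩ := Epoch.exists_class_of_countVal_ne d p.2 q.2 D' hD'ne
    exact ⟨l, mem_filter.mpr ⟨mem_univ _, by rw [hl]; exact ⟨hD'0, hD'ne⟩⟩⟩
  obtain ⟨l₀, hl₀T, hl₀max⟩ := exists_max_image T d hTne
  obtain ⟨h₀, hne⟩ := (mem_filter.mp hl₀T).2
  set D := d l₀ with hD
  have habove : ∀ D'' : ℕ, D < D'' →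
      (univ.filter fun i => d (p.2 i) = D'').card = (univ.filter fun i => d (q.2 i) = D'').card := by
    intro D'' hDD
    by_contra hne'
    obtain ⟨l, hl⟩ := Epoch.exists_class_of_countVal_ne d p.2 q.2 D'' hne'
    have hlT : l ∈ T := mem_filter.mpr ⟨mem_univ _, by rw [hl]; exact ⟨h₀.trans hDD, hne'⟩⟩
    have := hl₀max l hlT
    rw [hl] at this
    exact absurd hDD (not_lt.mpr this)
  have hpq : p ≠ q := by rintro rfl; exact hne rfl
  obtain ⟨hDa, hbelow_a⟩ := crit θa.natAbs hfa l₀ h₀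
  obtain ⟨hDb, hbelow_b⟩ := crit θb.natAbs hfb l₀ h₀
  rcases Nat.lt_or_gt_of_ne hne with hlt | hgt
  · rcases hsign with ⟨ha0, _⟩ | ⟨_, hb0⟩
    · have h := (weight_gap_theta d v R hv p q D hDa (hbelow_a p.2) habove hlt).1 ha0
      exact absurd h (not_lt.mpr (ha.2 q hpq.symm hb.1).le)
    · have h := (weight_gap_theta d v R hv p q D hDb (hbelow_b p.2) habove hlt).2 hb0
      exact absurd h (not_lt.mpr (hb.2 p hpq ha.1).le)
  · have habove' : ∀ D'' : ℕ, D < D'' →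
        (univ.filter fun i => d (q.2 i) = D'').card = (univ.filter fun i => d (p.2 i) = D'').card :=
      fun D'' h => (habove D'' h).symm
    rcases hsign with ⟨_, hb0⟩ | ⟨ha0, _⟩
    · have h := (weight_gap_theta d v R hv q p D hDb (hbelow_b q.2) habove' hgt).1 hb0
      exact absurd h (not_lt.mpr (hb.2 p hpq ha.1).le)
    · have h := (weight_gap_theta d v R hv q p D hDa (hbelow_a q.2) habove' hgt).2 ha0
      exact absurd h (not_lt.mpr (ha.2 q hpq.symm hb.1).le)

/-! ## 3. Counting: one term beyond `θ⋆`, at most `θ⋆ − 1` before it, per sign -/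

/-- **Per-sign count.**  With `θ⋆ = ⌊2mR/g⌋ + 1`: the chain indices `k` with `0 < σ·θ_k` (`σ = ±1`) number at most `θ⋆`. [this file] -/
theorem card_sign_le (d : Fin K → ℕ) (v ε : Fin m → Fin m → Fin K → ℤ) (R g : ℕ) (hg : 0 < g) (hv : ∀ i j l, (v i j l).natAbs ≤ R)
    (hgap : ∀ l l' : Fin K, d l' < d l → m * d l' + g ≤ d l) (hg0 : ∀ l : Fin K, 0 < d l → g ≤ d l)
    {n : ℕ} (θ : Fin (n + 1) → ℤ) (p : Fin (n + 1) → Equiv.Perm (Fin m) × (Fin m → Fin K))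
    (hθ : StrictMono θ) (hdom : ∀ k, IsDominant d v ε (θ k) (p k)) (hne : ∀ k : Fin n, p k.castSucc ≠ p k.succ)
    (σ : ℤ) (hσ : σ = 1 ∨ σ = -1) :
    (univ.filter fun k => 0 < σ * θ k).card ≤ 2 * m * R / g + 1 := by
  classical
  have hsm : StrictMono fun k => ∑ i, d ((p k).2 i) := by
    refine Fin.strictMono_iff_lt_succ.mpr fun k => ?_
    exact sum_d_lt_of_dominant d v ε (hθ k.castSucc_lt_succ) (hne k) (hdom _) (hdom _)
  set θs := 2 * m * R / g + 1 with hθs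
  have hθs_frozen : ∀ t : ℕ, θs ≤ t → 2 * m * R < t * g := by
    intro t ht
    have h1 : 2 * m * R < θs * g := by
      rw [hθs, add_mul, one_mul]
      have := Nat.lt_div_mul_add (a := 2 * m * R) hg
      linarith [Nat.div_mul_le_self (2 * m * R) g, Nat.mod_lt (2 * m * R) hg, Nat.div_add_mod (2 * m * R) g]
    exact h1.trans_le (Nat.mul_le_mul_right g ht)
  set I := univ.filter fun k => 0 < σ * θ k with hI
  set Ifar := I.filter fun k => θs ≤ (θ k).natAbs with hIfar
  set Inear := I.filter fun k => ¬ θs ≤ (θ k).natAbs with hInear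
  have hsplit : Ifar.card + Inear.card = I.card := card_filter_add_card_filter_not _
  -- far indices: all positive values frozen ⇒ equal slopes ⇒ at most one
  have hfar : Ifar.card ≤ 1 := by
    refine card_le_one.mpr fun a ha b hb => ?_
    have haI := (mem_filter.mp ha).1
    have hbI := (mem_filter.mp hb).1
    have hsign : (0 < θ a ∧ 0 < θ b) ∨ (θ a < 0 ∧ θ b < 0) := by
      have h1 := (mem_filter.mp haI).2
      have h2 := (mem_filter.mp hbI).2
      rcases hσ with rfl | rfl
      · left; constructor <;> linarith
      · right; constructor <;> linarith
    apply hsm.injective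
    show ∑ i, d ((p a).2 i) = ∑ i, d ((p b).2 i)
    have hcnt := countVal_eq_far d v ε R g hv hgap hg0 hsign (hθs_frozen _ (mem_filter.mp ha).2)
      (hθs_frozen _ (mem_filter.mp hb).2) (hdom a) (hdom b)
    have hz : ∀ r : Fin m → Fin K, ∑ i, d (r i) = ∑ i ∈ univ.filter (fun i => 0 < d (r i)), d (r i) := by
      intro r
      rw [← sum_filter_add_sum_filter_not univ (fun i => 0 < d (r i))]
      have h0 : ∑ i ∈ univ.filter (fun i => ¬ 0 < d (r i)), d (r i) = 0 :=
        sum_eq_zero fun i hi => by have := (mem_filter.mp hi).2; omega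
      rw [h0, add_zero]
    rw [hz (p a).2, hz (p b).2, sum_above_eq_of_countVal d (p a).2 (p b).2 0 (fun D hD => hcnt D hD)]
  -- near indices: `|θ_k| ∈ [1, θ⋆ − 1]`, injective in `θ_k`
  have hnear : Inear.card ≤ θs - 1 := by
    have hmaps : ∀ k ∈ Inear, (θ k).natAbs ∈ Finset.Ico 1 θs := by
      intro k hk
      have hkI := (mem_filter.mp hk).1
      have hlt : ¬ θs ≤ (θ k).natAbs := (mem_filter.mp hk).2
      have hnz : θ k ≠ 0 := by
        intro h0; have h1 := (mem_filter.mp hkI).2; rw [h0, mul_zero] at h1; exact lt_irrefl _ h1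
      rw [Finset.mem_Ico]
      exact ⟨Int.natAbs_pos.mpr hnz, not_le.mp hlt⟩
    have hinj : Set.InjOn (fun k => (θ k).natAbs) ↑Inear := by
      intro a ha b hb hab
      rw [coe_filter, Set.mem_setOf_eq] at ha hb
      have h1 := (mem_filter.mp ha.1).2
      have h2 := (mem_filter.mp hb.1).2
      apply hθ.injective
      simp only at hab
      rcases hσ with rfl | rfl
      · have e1 : ((θ a).natAbs : ℤ) = θ a := Int.natAbs_of_nonneg (by linarith)
        have e2 : ((θ b).natAbs : ℤ) = θ b := Int.natAbs_of_nonneg (by linarith)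
        have : ((θ a).natAbs : ℤ) = ((θ b).natAbs : ℤ) := by exact_mod_cast hab
        linarith
      · have e1 : ((θ a).natAbs : ℤ) = -θ a := Int.ofNat_natAbs_of_nonpos (by linarith)
        have e2 : ((θ b).natAbs : ℤ) = -θ b := Int.ofNat_natAbs_of_nonpos (by linarith)
        have : ((θ a).natAbs : ℤ) = ((θ b).natAbs : ℤ) := by exact_mod_cast hab
        linarith
    calc Inear.card ≤ (Finset.Ico 1 θs).card := card_le_card_of_injOn _ hmaps hinj
      _ = θs - 1 := Nat.card_Ico 1 θs
  have hθs1 : 1 ≤ θs := by rw [hθs]; exact Nat.le_add_left 1 _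
  calc I.card = Ifar.card + Inear.card := hsplit.symm
    _ ≤ 1 + (θs - 1) := Nat.add_le_add hfar hnear
    _ = θs := by omega

/-- **THE LEX GAP LAW.**  In a dominance design of format `(m, K)` with valuations `|v| ≤ R` and exponents super-increasing with slack `g ≥ 1`
(`d l' < d l → m·d l' + g ≤ d l`, and `g ≤ d l` whenever `d l > 0`), every chain of unique optima at strictly increasing integer slopes with distinct
consecutive terms has `n + 1 ≤ 2·(⌊2mR/g⌋ + 1) + 1`. [this file] -/
theorem chain_le (d : Fin K → ℕ) (v ε : Fin m → Fin m → Fin K → ℤ) (R g : ℕ) (hg : 0 < g) (hv : ∀ i j l, (v i j l).natAbs ≤ R)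
    (hgap : ∀ l l' : Fin K, d l' < d l → m * d l' + g ≤ d l) (hg0 : ∀ l : Fin K, 0 < d l → g ≤ d l)
    {n : ℕ} (θ : Fin (n + 1) → ℤ) (p : Fin (n + 1) → Equiv.Perm (Fin m) × (Fin m → Fin K))
    (hθ : StrictMono θ) (hdom : ∀ k, IsDominant d v ε (θ k) (p k)) (hne : ∀ k : Fin n, p k.castSucc ≠ p k.succ) :
    n + 1 ≤ 2 * (2 * m * R / g + 1) + 1 := by
  classical
  set J := 2 * m * R / g + 1 with hJ
  have hpos := card_sign_le d v ε R g hg hv hgap hg0 θ p hθ hdom hne 1 (Or.inl rfl)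
  have hneg := card_sign_le d v ε R g hg hv hgap hg0 θ p hθ hdom hne (-1) (Or.inr rfl)
  have hzero : (univ.filter fun k => θ k = 0).card ≤ 1 := by
    refine card_le_one.mpr fun a ha b hb => hθ.injective ?_
    rw [(mem_filter.mp ha).2, (mem_filter.mp hb).2]
  have hcover : (univ : Finset (Fin (n + 1))) ⊆
      ((univ.filter fun k => 0 < (1 : ℤ) * θ k) ∪ (univ.filter fun k => 0 < (-1 : ℤ) * θ k)) ∪
        (univ.filter fun k => θ k = 0) := by
    intro k _
    rcases lt_trichotomy (θ k) 0 with h | h | h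
    · exact mem_union_left _ (mem_union_right _ (mem_filter.mpr ⟨mem_univ _, by linarith⟩))
    · exact mem_union_right _ (mem_filter.mpr ⟨mem_univ _, h⟩)
    · exact mem_union_left _ (mem_union_left _ (mem_filter.mpr ⟨mem_univ _, by linarith⟩))
  calc n + 1 = (univ : Finset (Fin (n + 1))).card := by rw [card_univ, Fintype.card_fin]
    _ ≤ (((univ.filter fun k => 0 < (1 : ℤ) * θ k) ∪ (univ.filter fun k => 0 < (-1 : ℤ) * θ k)) ∪
          (univ.filter fun k => θ k = 0)).card := card_le_card hcover
    _ ≤ ((univ.filter fun k => 0 < (1 : ℤ) * θ k).card + (univ.filter fun k => 0 < (-1 : ℤ) * θ k).card) +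
          (univ.filter fun k => θ k = 0).card :=
        (card_union_le _ _).trans (Nat.add_le_add_right (card_union_le _ _) _)
    _ ≤ (J + J) + 1 := Nat.add_le_add (Nat.add_le_add hpos hneg) hzero
    _ = 2 * J + 1 := by ring

end LexGap

end Summit.ValiantsHypothesis.ValiantsHypothesis.Theorems.KPlusLogSqLaw
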